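import Mathlib
import HarnessLib
import Summits.Ventures.LatticeQCDFlow.Exactness.NCMCGeneralSpaceKishSampleSize

/-!
# NCMCGeneralSpaceKishOverestimate — WITH TOO FEW RECORDS THE PRINTED KISH ESS IS OVER-OPTIMISTIC:
# for `N ≤ e^{L₂ − t}` independent forward records the sample Kish fraction exceeds
# `(1 − η)²/(1 − δ)` times its population value `ESS_F` except on an event of probability
# `≤ e^{−t/2} + P₂{…}/(1 − δ) + (1/ESS_F − 1)/(N η²)`

HONEST FRAMING: exact (Metropolis-corrected) sampling algorithms for lattice gauge theory;
figures of merit are autocorrelation/cost numbers at stated couplings and volumes; no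
continuum-physics claim.

Venture `LatticeQCDFlow` (cell pub-lqcd); FANOUT row 19 (`su2-snf`, GEN-8 — the typed form of the
row's «unranked (low-ESS)» boarding rule and of the WORK-MGF-CHECK finding that the one low-ESS arm's
Kish statistic is a finite-sample artefact: HOME/su2-snf/HANDOFF.md P8/P12).  OUR WORK (elementary:
a union bound); nothing is cited as a fact.  Two tree inputs: the NECESSITY half of the Kish-
denominator sample-size law (`Exactness/NCMCGeneralSpaceKishSampleSize.kish_sampleSize_necessary`,
GEN-7: with `N ≤ e^{L₂ − t}` records the sample second moment of the weights under-shoots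
`(1 − δ)·E_F e^{−2W}` except with probability `≤ e^{−t/2} + P₂{log ρ₂ ≤ L₂ − t/2}/(1 − δ)`), and
Chebyshev for the sample FIRST moment of the weights (Mathlib `meas_ge_le_variance_div_sq`,
`variance_sum_pi`; its relative variance is `(1/ESS_F − 1)/N`).  On the complement of both events
the numerator of the Kish fraction is `> (1 − η)²(E_F e^{−W})²` and the denominator is
`< (1 − δ)·E_F e^{−2W}`, so the fraction exceeds `((1 − η)²/(1 − δ))·ESS_F`.

* `kishFrac_gt_of_moments` — the deterministic step: `S₁ > (1 − η)m₁ ≥ 0`, `0 < S₂ < (1 − δ)Z₂` ⇒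
  `S₁²/S₂ > ((1 − η)²/(1 − δ))·(m₁²/Z₂)`;
* `measureReal_meanWeight_dev_ge_le` — Chebyshev for the mean forward weight of `N ≥ 1` independent
  records: `P(|(1/N)Σᵢ e^{−W(εᵢ)}/E_F e^{−W} − 1| ≥ η) ≤ (1/ESS_F − 1)/(N η²)`;
* **`kishFrac_le_prob_le`** — `e^{−W} ∈ L²(P_F)`, `t ≥ 0`, `1 ≤ N ≤ e^{L₂ − t}`, `δ ∈ (0,1)`,
  `η ∈ (0,1]`:
  `P_F^{⊗N}{ ((1/N)Σ e^{−W(εᵢ)})²/((1/N)Σ e^{−2W(εᵢ)}) ≤ ((1−η)²/(1−δ))·ESS_F }`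
  `≤ e^{−t/2} + P₂{−2W − log E_F e^{−2W} ≤ L₂ − t/2}/(1 − δ) + (1/ESS_F − 1)/(N η²)`.

Reading (value-free): in the regime `e^{L₁} ≪ N ≪ e^{L₂}` (first moment resolved, second not —
Gaussian dictionary: `e^{s/2} ≪ N ≪ e^{2s}`) the printed Kish ESS/N sits ABOVE `ESS_F·(1−η)²/(1−δ)`
with high probability: a low-`N` arm's Kish figure is an upper-biased statistic and must not be
ranked against arms with `N ≫ e^{L₂}` — the row's «unranked (low-ESS)» label.  NOT CLAIMED: the size
of the overshoot; correlated records (the two inputs have restart-chain versions in this topic, the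
union bound is identical and not typed here).
-/

namespace Summit.Ventures.LatticeQCDFlow.Exactness.GeneralNCMC

open MeasureTheory ProbabilityTheory Set Filter
open scoped ENNReal

/-- The deterministic step: if the mean weight is within relative `η ≤ 1` of `m₁ > 0` from below
(`(1 − η)·m₁ < S₁`) and the mean squared weight is positive and below `(1 − δ)·Z₂` (`δ < 1`, `Z₂ > 0`),
then the Kish fraction `S₁²/S₂` exceeds `((1 − η)²/(1 − δ))·(m₁²/Z₂)`. -/
theorem kishFrac_gt_of_moments {S₁ S₂ m₁ Z₂ η δ : ℝ} (hm : 0 < m₁) (hZ : 0 < Z₂) (hη : η ≤ 1)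
    (hδ : δ < 1) (hS₁ : (1 - η) * m₁ < S₁) (hS₂0 : 0 < S₂) (hS₂ : S₂ < (1 - δ) * Z₂) :
    (1 - η) ^ 2 / (1 - δ) * (m₁ ^ 2 / Z₂) < S₁ ^ 2 / S₂ := by
  have h1 : 0 ≤ (1 - η) * m₁ := mul_nonneg (by linarith) hm.le
  have hnum : ((1 - η) * m₁) ^ 2 < S₁ ^ 2 := by
    have hS₁pos : 0 < S₁ := lt_of_le_of_lt h1 hS₁
    nlinarith
  have hden : 0 < (1 - δ) * Z₂ := mul_pos (by linarith) hZ
  calc (1 - η) ^ 2 / (1 - δ) * (m₁ ^ 2 / Z₂) = ((1 - η) * m₁) ^ 2 / ((1 - δ) * Z₂) := by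
        field_simp
    _ ≤ S₁ ^ 2 / ((1 - δ) * Z₂) := div_le_div_of_nonneg_right hnum.le hden.le
    _ < S₁ ^ 2 / S₂ := by
        apply div_lt_div_of_pos_left _ hS₂0 hS₂
        exact lt_of_le_of_lt (sq_nonneg _) hnum

variable {Ω E : Type*} [MeasurableSpace Ω] [MeasurableSpace E]

namespace CrooksPair

variable {ν₀ ν₁ : Measure Ω} {κF κR : Kernel Ω E} {s e : E → Ω} {W : E → ℝ}

/-- **Chebyshev for the mean forward weight** of `N ≥ 1` independent records: with
`m₁ = E_F e^{−W}`, `Z₂ = E_F e^{−2W}`, `ESS_F = m₁²/Z₂`: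
`P_F^{⊗N}( |(1/N)Σᵢ e^{−W(εᵢ)}/m₁ − 1| ≥ η ) ≤ (1/ESS_F − 1)/(N η²)`. -/
theorem measureReal_meanWeight_dev_ge_le [IsFiniteMeasure ν₀] [IsFiniteMeasure ν₁]
    [IsMarkovKernel κF] [IsMarkovKernel κR] (h0 : ν₀ univ ≠ 0) (h1 : ν₁ univ ≠ 0)
    (h : CrooksPair ν₀ ν₁ κF κR s e W)
    (hw2 : MemLp (fun ε => Real.exp (-W ε)) 2 (fwdPathLaw ν₀ κF))
    {N : ℕ} (hN0 : N ≠ 0) {η : ℝ} (hη0 : 0 < η) :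
    ((Measure.pi fun _ : Fin N => fwdPathLaw ν₀ κF)
        {x | η ≤ |(1 / (N : ℝ)) * ∑ i, Real.exp (-W (x i))
          / (∫ ε, Real.exp (-W ε) ∂(fwdPathLaw ν₀ κF)) - 1|}).toReal
      ≤ (1 / ((∫ ε, Real.exp (-W ε) ∂(fwdPathLaw ν₀ κF)) ^ 2
            / ∫ ε, Real.exp (-(2 * W ε)) ∂(fwdPathLaw ν₀ κF)) - 1) / (N * η ^ 2) := by
  haveI := isProbabilityMeasure_fwdPathLaw ν₀ h0 κF
  set PF := fwdPathLaw ν₀ κF with hPF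
  set P := Measure.pi fun _ : Fin N => PF with hP
  set m₁ : ℝ := ∫ ε, Real.exp (-W ε) ∂PF with hm₁
  set Z₂ : ℝ := ∫ ε, Real.exp (-(2 * W ε)) ∂PF with hZ₂
  have hW := h.measurable_W
  have hm₁pos : 0 < m₁ := by rw [hm₁, hPF, h.integral_exp_neg_work]; exact toReal_ratio_pos h0 h1
  have hNpos : (0 : ℝ) < N := by exact_mod_cast Nat.pos_of_ne_zero hN0
  -- the normalised weight `ρ̃ = e^{−W}/m₁`: mean 1, second moment `Z₂/m₁² = 1/ESS_F`
  set ρ : E → ℝ := fun ε => Real.exp (-W ε) / m₁ with hρ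
  have hρm : Measurable ρ := (Real.measurable_exp.comp hW.neg).div_const _
  have hρ2 : MemLp ρ 2 PF := by
    have h2 := hw2.const_mul (1 / m₁)
    refine (memLp_congr_ae (Eventually.of_forall fun ε => ?_)).1 h2
    simp only [hρ]
    ring
  have hρ1 : ∫ ε, ρ ε ∂PF = 1 := by
    simp only [hρ]
    rw [integral_div, ← hm₁, div_self hm₁pos.ne']
  have hsq : ∀ ε, Real.exp (-W ε) ^ 2 = Real.exp (-(2 * W ε)) := fun ε => by
    rw [sq, ← Real.exp_add]; congr 1; ring
  have hρsq : ∫ ε, ρ ε ^ 2 ∂PF = Z₂ / m₁ ^ 2 := by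
    simp only [hρ]
    have : ∀ ε, (Real.exp (-W ε) / m₁) ^ 2 = (1 / m₁ ^ 2) * Real.exp (-(2 * W ε)) := fun ε => by
      rw [div_pow, hsq ε]; ring
    simp_rw [this]
    rw [integral_const_mul, ← hZ₂]; ring
  have hvarρ : Var[ρ; PF] = Z₂ / m₁ ^ 2 - 1 := by
    rw [variance_eq_sub hρ2]
    have e1 : ∫ ε, ((fun ε => ρ ε) ^ 2) ε ∂PF = Z₂ / m₁ ^ 2 := by
      rw [← hρsq]; rfl
    have e2 : (∫ ε, (fun ε => ρ ε) ε ∂PF) = 1 := hρ1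
    rw [e1, e2]; ring
  -- the sum `S = Σᵢ ρ(xᵢ)` under the product measure: mean `N`, variance `N·Var ρ`
  set S : (Fin N → E) → ℝ := ∑ i : Fin N, fun x => ρ (x i) with hS
  have hS_apply : ∀ x, S x = ∑ i, ρ (x i) := fun x => by simp only [hS, Finset.sum_apply]
  have hY2 : ∀ i : Fin N, MemLp (fun x : Fin N → E => ρ (x i)) 2 P := fun i =>
    hρ2.comp_measurePreserving (measurePreserving_eval (fun _ : Fin N => PF) i)
  have hS2 : MemLp S 2 P := memLp_finsetSum' _ (fun i _ => hY2 i)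
  have hSvar : Var[S; P] = N * (Z₂ / m₁ ^ 2 - 1) := by
    rw [hS, hP, variance_sum_pi (X := fun _ : Fin N => ρ) (fun _ => hρ2)]
    simp only [hvarρ, Finset.sum_const, Finset.card_univ, Fintype.card_fin, nsmul_eq_mul]
  have hYint : ∀ i : Fin N, ∫ x, ρ (x i) ∂P = 1 := by
    intro i
    have hmp := measurePreserving_eval (fun _ : Fin N => PF) i
    rw [← hρ1, ← hmp.map_eq, integral_map (measurable_pi_apply i).aemeasurable
      hρm.aestronglyMeasurable]
  have hSint : ∫ x, S x ∂P = N := by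
    simp_rw [hS_apply]
    rw [integral_finsetSum _ (fun i _ => (hY2 i).integrable one_le_two)]
    simp only [hYint, Finset.sum_const, Finset.card_univ, Fintype.card_fin, nsmul_eq_mul, mul_one]
  -- the sample mean `X = (1/N) S`, written exactly as in the statement
  have hXdef : (fun x : Fin N → E => (1 / (N : ℝ)) * ∑ i, Real.exp (-W (x i)) / m₁)
      = fun x => (1 / (N : ℝ)) * S x := by
    funext x
    rw [hS_apply]
  have hX2 : MemLp (fun x : Fin N → E => (1 / (N : ℝ)) * ∑ i, Real.exp (-W (x i)) / m₁) 2 P := by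
    rw [hXdef]; exact hS2.const_mul _
  have hXint : ∫ x, (1 / (N : ℝ)) * ∑ i, Real.exp (-W (x i)) / m₁ ∂P = 1 := by
    have : ∫ x, (1 / (N : ℝ)) * ∑ i, Real.exp (-W (x i)) / m₁ ∂P = ∫ x, (1 / (N : ℝ)) * S x ∂P :=
      congrArg (fun F : (Fin N → E) → ℝ => ∫ x, F x ∂P) hXdef
    rw [this, integral_const_mul, hSint]; field_simp
  have hXvar : Var[fun x : Fin N → E => (1 / (N : ℝ)) * ∑ i, Real.exp (-W (x i)) / m₁; P]
      = (Z₂ / m₁ ^ 2 - 1) / N := by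
    rw [hXdef, variance_const_mul, hSvar]; field_simp
  -- Chebyshev
  have hcheb := meas_ge_le_variance_div_sq hX2 hη0
  rw [hXint, hXvar] at hcheb
  have hnn : 0 ≤ (Z₂ / m₁ ^ 2 - 1) / N / η ^ 2 := by
    have : 0 ≤ Z₂ / m₁ ^ 2 - 1 := by rw [← hvarρ]; exact variance_nonneg _ _
    positivity
  calc (P {x | η ≤ |(1 / (N : ℝ)) * ∑ i, Real.exp (-W (x i)) / m₁ - 1|}).toReal
      ≤ (ENNReal.ofReal ((Z₂ / m₁ ^ 2 - 1) / N / η ^ 2)).toReal :=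
        ENNReal.toReal_mono ENNReal.ofReal_ne_top hcheb
    _ = (Z₂ / m₁ ^ 2 - 1) / N / η ^ 2 := ENNReal.toReal_ofReal hnn
    _ = (1 / (m₁ ^ 2 / Z₂) - 1) / (N * η ^ 2) := by
        rw [one_div_div, div_div]

/-- **THE PRINTED KISH FRACTION IS OVER-OPTIMISTIC WITH TOO FEW RECORDS.**  Crooks pair with
`e^{−W} ∈ L²(P_F)`; `m₁ = E_F e^{−W}`, `Z₂ = E_F e^{−2W}`, `ESS_F = m₁²/Z₂`, `P₂ = P_F.tilted(−2W)`,
`L₂ = KL(P₂ ‖ P_F)`; `t ≥ 0`, `1 ≤ N ≤ e^{L₂ − t}` independent forward records, `δ ∈ (0, 1)`,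
`η ∈ (0, 1]`.  Then the event that the sample Kish fraction `((1/N)Σ wᵢ)²/((1/N)Σ wᵢ²)` (`= ESŜ/N`,
`wᵢ = e^{−W(εᵢ)}`) is AT MOST `((1 − η)²/(1 − δ))·ESS_F` has probability
`≤ e^{−t/2} + P₂{−2W − log Z₂ ≤ L₂ − t/2}/(1 − δ) + (1/ESS_F − 1)/(N η²)` — outside it the printed
figure exceeds that multiple of the population value. -/
theorem kishFrac_le_prob_le [IsFiniteMeasure ν₀] [IsFiniteMeasure ν₁]
    [IsMarkovKernel κF] [IsMarkovKernel κR] (h0 : ν₀ univ ≠ 0) (h1 : ν₁ univ ≠ 0)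
    (h : CrooksPair ν₀ ν₁ κF κR s e W)
    (hw2 : MemLp (fun ε => Real.exp (-W ε)) 2 (fwdPathLaw ν₀ κF))
    {t : ℝ} (ht : 0 ≤ t) {N : ℕ} (hN0 : N ≠ 0)
    (hN : (N : ℝ) ≤ Real.exp ((∫ ε, (-(2 * W ε)
        - Real.log (∫ ε', Real.exp (-(2 * W ε')) ∂(fwdPathLaw ν₀ κF)))
          ∂((fwdPathLaw ν₀ κF).tilted fun ε => -(2 * W ε))) - t))
    {δ : ℝ} (hδ0 : 0 < δ) (hδ1 : δ < 1) {η : ℝ} (hη0 : 0 < η) (hη1 : η ≤ 1) :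
    ((Measure.pi fun _ : Fin N => fwdPathLaw ν₀ κF)
        {x | ((1 / (N : ℝ)) * ∑ i, Real.exp (-W (x i))) ^ 2
              / ((1 / (N : ℝ)) * ∑ i, Real.exp (-(2 * W (x i))))
            ≤ (1 - η) ^ 2 / (1 - δ) *
              ((∫ ε, Real.exp (-W ε) ∂(fwdPathLaw ν₀ κF)) ^ 2
                / ∫ ε, Real.exp (-(2 * W ε)) ∂(fwdPathLaw ν₀ κF))}).toReal
      ≤ Real.exp (-t / 2)
        + (((fwdPathLaw ν₀ κF).tilted fun ε => -(2 * W ε))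
            {ε | -(2 * W ε) - Real.log (∫ ε', Real.exp (-(2 * W ε')) ∂(fwdPathLaw ν₀ κF))
              ≤ (∫ ε, (-(2 * W ε) - Real.log (∫ ε', Real.exp (-(2 * W ε')) ∂(fwdPathLaw ν₀ κF)))
                  ∂((fwdPathLaw ν₀ κF).tilted fun ε => -(2 * W ε))) - t / 2}).toReal / (1 - δ)
        + (1 / ((∫ ε, Real.exp (-W ε) ∂(fwdPathLaw ν₀ κF)) ^ 2
            / ∫ ε, Real.exp (-(2 * W ε)) ∂(fwdPathLaw ν₀ κF)) - 1) / (N * η ^ 2) := by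
  haveI := isProbabilityMeasure_fwdPathLaw ν₀ h0 κF
  set PF := fwdPathLaw ν₀ κF with hPF
  set P := Measure.pi fun _ : Fin N => PF with hP
  set m₁ : ℝ := ∫ ε, Real.exp (-W ε) ∂PF with hm₁
  set Z₂ : ℝ := ∫ ε, Real.exp (-(2 * W ε)) ∂PF with hZ₂
  have hW := h.measurable_W
  have hsq : ∀ ε, Real.exp (-W ε) ^ 2 = Real.exp (-(2 * W ε)) := fun ε => by
    rw [sq, ← Real.exp_add]; congr 1; ring
  have hint : Integrable (fun ε => Real.exp (-(2 * W ε))) PF :=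
    hw2.integrable_sq.congr (Eventually.of_forall fun ε => hsq ε)
  have hm₁pos : 0 < m₁ := by rw [hm₁, hPF, h.integral_exp_neg_work]; exact toReal_ratio_pos h0 h1
  have hZ₂pos : 0 < Z₂ := by rw [hZ₂]; exact integral_exp_pos hint
  have hNpos : (0 : ℝ) < N := by exact_mod_cast Nat.pos_of_ne_zero hN0
  -- the two bad events
  set A : Set (Fin N → E) := {x | 1 - δ ≤ (1 / (N : ℝ)) * ∑ i, Real.exp (-(2 * W (x i))) / Z₂}
    with hA
  set B : Set (Fin N → E) := {x | η ≤ |(1 / (N : ℝ)) * ∑ i, Real.exp (-W (x i)) / m₁ - 1|}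
    with hB
  have hPA : (P A).toReal ≤ Real.exp (-t / 2)
      + ((PF.tilted fun ε => -(2 * W ε))
          {ε | -(2 * W ε) - Real.log Z₂ ≤ (∫ ε, (-(2 * W ε) - Real.log Z₂)
              ∂(PF.tilted fun ε => -(2 * W ε))) - t / 2}).toReal / (1 - δ) :=
    h.kish_sampleSize_necessary h0 hint ht hN hδ0 hδ1
  have hPB : (P B).toReal ≤ (1 / (m₁ ^ 2 / Z₂) - 1) / (N * η ^ 2) :=
    h.measureReal_meanWeight_dev_ge_le h0 h1 hw2 hN0 hη0
  -- the target event is contained in `A ∪ B`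
  have hsub : {x : Fin N → E | ((1 / (N : ℝ)) * ∑ i, Real.exp (-W (x i))) ^ 2
        / ((1 / (N : ℝ)) * ∑ i, Real.exp (-(2 * W (x i))))
        ≤ (1 - η) ^ 2 / (1 - δ) * (m₁ ^ 2 / Z₂)} ⊆ A ∪ B := by
    intro x hx
    simp only [mem_setOf_eq] at hx
    by_contra hnot
    simp only [hA, hB, mem_union, mem_setOf_eq, not_or, not_le] at hnot
    obtain ⟨hxA, hxB⟩ := hnot
    set S₁ : ℝ := (1 / (N : ℝ)) * ∑ i, Real.exp (-W (x i)) with hS₁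
    set S₂ : ℝ := (1 / (N : ℝ)) * ∑ i, Real.exp (-(2 * W (x i))) with hS₂
    -- `S₂ < (1 − δ) Z₂`
    have h2 : (1 / (N : ℝ)) * ∑ i, Real.exp (-(2 * W (x i))) / Z₂ = S₂ / Z₂ := by
      rw [hS₂, ← Finset.sum_div, mul_div_assoc]
    rw [h2, div_lt_iff₀ hZ₂pos] at hxA
    -- `(1 − η) m₁ < S₁`
    have h3 : (1 / (N : ℝ)) * ∑ i, Real.exp (-W (x i)) / m₁ = S₁ / m₁ := by
      rw [hS₁, ← Finset.sum_div, mul_div_assoc]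
    rw [h3] at hxB
    have h4 : 1 - η < S₁ / m₁ := by
      have := (abs_lt.1 hxB).1
      linarith
    rw [lt_div_iff₀ hm₁pos] at h4
    -- `S₂ > 0`
    haveI : Nonempty (Fin N) := ⟨⟨0, Nat.pos_of_ne_zero hN0⟩⟩
    have h5 : 0 < S₂ := by
      rw [hS₂]
      exact mul_pos (by positivity) (Finset.sum_pos (fun i _ => Real.exp_pos _)
        Finset.univ_nonempty)
    exact absurd hx (not_le.2 (kishFrac_gt_of_moments hm₁pos hZ₂pos hη1 hδ1 h4 h5 hxA))
  calc (P {x : Fin N → E | ((1 / (N : ℝ)) * ∑ i, Real.exp (-W (x i))) ^ 2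
          / ((1 / (N : ℝ)) * ∑ i, Real.exp (-(2 * W (x i))))
          ≤ (1 - η) ^ 2 / (1 - δ) * (m₁ ^ 2 / Z₂)}).toReal
      ≤ (P (A ∪ B)).toReal := ENNReal.toReal_mono (measure_ne_top _ _) (measure_mono hsub)
    _ ≤ (P A).toReal + (P B).toReal := measureReal_union_le A B
    _ ≤ _ := add_le_add hPA hPB

end CrooksPair

end Summit.Ventures.LatticeQCDFlow.Exactness.GeneralNCMC
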